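import Mathlib
import HarnessLib

/-!
# Hintz 2026, Lemma 6.6: the indicial roots of the gauge potential wave operator — kernel reproduction
# (and the root bookkeeping of Lemma 8.4 that feeds the indicial gap `ε_ind`)

CITATION HEADER (lean-in-tree rule 2026-08-18).  P. Hintz, *Nonlinear stability of subextremal Kerr black holes*,
arXiv:2606.28253 **v2** (2026-08-03), bib key `Hintz2026` — an UNREFEREED CLAIM under adjudication in this library
(`Literature.Geometry.Lorentzian.hintz_kerr_stability_subextremal_cauchy` carries its main theorem as
`@[claim "Hintz2026" "under-review"]`).  TeX line numbers `l.N` refer to the v2 source `kerr-stab-r.tex`.  This file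
REPRODUCES, in the kernel, the one fully printed symbolic computation of the paper's linear theory — Lemma 6.6
(`LemmaWGInd`, l.6041–6067, p. 117): the indicial roots of the zero-energy gauge potential wave operator
`□^Υ_{g_b,E^Υ}(0)^` (equivalently of its Minkowskian normal operator) — and records what that computation implies for
the root list of Lemma 8.4 (`LemmaWEInd`, l.7545–7611, p. 149), whose own determinant factorisations (items 1–5 of its
proof, "performed with Wolfram Mathematica", l.7578) are NOT reproduced here (their input, the `7 × 7` indicial
families of `L̂(0)`, is printed only through the spherical-operator identities of §§2–3).  Nothing in this file is a
stability statement; it is arithmetic about explicitly printed matrices.  Written by the audit cell `pub-kerr`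
(HINTZ-PLAN.md T5(b), risk item R8); a second, independent engine (exact rational polynomial arithmetic in Python,
`b2b-kerr-adep1/g4/wgind_check.py`) agrees with every identity below at 5 parameter points × `l = 1, …, 6`.

## What is printed (verbatim shape)

Proof of Lemma 6.6, l.6057–6064: "Acting on forms of pure type, the indicial family of `□^Υ_{g_b,E^Υ}` is given by
`N_{s0}(λ) = −λ² + λ + [[1,−1],[−1,1]] + γ^Υ [[−(1+e^Υ)λ + 2e^Υ, −(1−e^Υ)λ − 2e^Υ],[(1−e^Υ)λ + 2e^Υ, (1+e^Υ)λ − 2e^Υ]]`,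
`N_{s l}(λ) = −λ² + λ + diag(l(l+1), l(l+1), l(l+1)−1) + [[1,−1,−l(l+1)],[−1,1,l(l+1)],[−2,2,1]]
            + γ^Υ [[−(1+e^Υ)λ + 2e^Υ, −(1−e^Υ)λ − 2e^Υ, −e^Υ l(l+1)],[(1−e^Υ)λ + 2e^Υ, (1+e^Υ)λ − 2e^Υ, −e^Υ l(l+1)],[2,2,0]]`,
`N_{v l}(λ) = −λ² + λ + l(l+1)`; here `l ≥ 1`.  One then finds by explicit calculation that `det N_{s0}` factors, with
the stated `s0` roots; likewise for the `s1` and `v1` roots."  Statement, l.6043–6054: "All indicial roots … are simple.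
… `s0` roots: `−λ^Υ_{s0,1}, 0, λ^Υ_{s0,1}, 2`; `s l` roots, `l ≥ 1`: `−λ^Υ_{s l,l+1}, −λ^Υ_{s l,l}, −l+1, λ^Υ_{s l,l},
λ^Υ_{s l,l+1}, l+2`; `v l` roots, `l ≥ 1`: `−l, l+1`, where
`λ^Υ_{s l,l} = ( l(l+1) + ½ + 2e^Υ(γ^Υ)² − √( l(l+1) + (½ + 2e^Υ(γ^Υ)²)² ) )^{1/2}`,
`λ^Υ_{s l,l+1} = ( l(l+1) + ½ + 2e^Υ(γ^Υ)² + √( … ) )^{1/2}`.  In particular `λ^Υ_{s0,1} = √(1 + 4e^Υ(γ^Υ)²)`."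

## What is proved here (`e = e^Υ`, `γ = γ^Υ`, `z = e γ²`, `L = l(l+1)`; all over `ℝ`)

1. `det_Ns0`, `det_Nsl`, `Nvl_eq`: the three determinant identities, for ALL real parameters:
   `det N_{s0}(λ) = λ(λ−2)(λ² − (1+4z))`, `det N_{s l}(λ) = −(λ+l−1)(λ−l−2)(λ⁴ − (2L+1+4z)λ² + L(L+4z))`,
   `N_{v l}(λ) = −(λ+l)(λ−l−1)` (`ring` on the printed matrices; `L` may be any real number).
2. `quartic_factor`, `lamLo_sq`, `lamHi_sq`, `det_Nsl_roots`: for `L ≥ 0`, `z ≥ 0` the quartic is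
   `(λ² − λ_{l,l}²)(λ² − λ_{l,l+1}²)` with the printed nested radicals, so the root lists are exactly the printed ones;
   `lamHiSq_zero`, `det_Ns0_roots` : `λ^Υ_{s0,1} = √(1+4z)` (the "In particular").
3. Location (`l ≥ 1`, `z ≥ 0`): `l ≤ λ_{l,l} < l+1 ≤ λ_{l,l+1}` (`le_lamLo`, `lamLo_lt`, `le_lamHi`), hence the
   Lemma-8.4-facing signs `one_sub_lamLo_nonpos` (`1 − λ_{l,l} ≤ 0`), `one_sub_sqrt_nonpos` (`1 − λ^Υ_{s0,1} ≤ 0`),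
   `lemma84_sl_explicit_roots_avoid_gap`, `lemma84_s1_explicit_roots_avoid_gap`: the explicitly printed (non-`𝓒`)
   roots of Lemma 8.4 avoid the open interval `(0, 1)`, and the `s0` entries "`−λ^Υ_{s0,1}+1`" and "`0`" of Lemma 8.4 COINCIDE iff `e^Υ γ^Υ = 0`
   (`lemma84_s0_coincide_iff`) — the kernel form of the paper's remark that a non-zero `e^Υ` "remove[s] integer
   coincidences in indicial roots of zero energy operators" (l.4173); Lemma 8.4's simplicity clause thus uses the
   standing convention `e^Υ, γ^Υ > 0` (Def 4.1, footnote l.4144), which it does not restate.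
4. SIMPLICITY, with its exact range: `sl_roots_strictMono` — for `l ≥ 1` and `0 ≤ z < 10/7` the six `s l` roots
   form a strictly increasing chain, hence are pairwise distinct (the only possible coincidence for `z ≥ 0` is
   `λ_{l,l+1} = l+2`, which happens exactly at `z = (l+1)(2l+3)/(3l+4) ≥ 10/7`: `lamHiSq_eq_at_coincidence`,
   `lamHi_lt_of_lt`); `s0_roots_pairwise_ne` — for `z ≥ 0`, `z ≠ 3/4` the four `s0` roots are distinct;
   `vl_roots_ne`.  Hence `all_simple_of_lt` : ALL printed roots are simple whenever `0 ≤ e^Υ(γ^Υ)² < 3/4`.  Conversely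
   `det_Ns0_double_root` : at `e^Υ(γ^Υ)² = 3/4`, `det N_{s0}(λ) = λ(λ−2)²(λ+2)` (double root `2 = λ^Υ_{s0,1}`), and
   `det_Ns1_double_root` : at `e^Υ(γ^Υ)² = 10/7`, `det N_{s1}(λ) = −λ(λ−3)²(λ+3)(λ² − 12/7)` (double root `3 = l+2`).
   So the printed sentence "All indicial roots … are simple" is TRUE on `0 ≤ e^Υ(γ^Υ)² < 3/4` and FALSE as an
   unqualified statement; the paper only ever uses it for "small `e^Υ` and `γ^Υ`" (l.6069; Def 4.1 footnote), where
   the kernel confirms it — recorded by the audit cell as a hypothesis left implicit in print, not as a gap.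
5. `epsInd_exists` : the bookkeeping behind "In particular, there is a positive number `ε_ind > 0` such that no
   indicial root has real part in `(0, ε_ind)`" (Lemma 8.4, l.7557–7561) — given that the explicitly printed roots
   avoid `(0,1)` (items 3–4) it remains to bound the `𝓒`-superscript roots shifted by `−1`, about which the paper
   prints ([CD] Thm M0 as recalled in Thm 7.1(3), l.6831; l.6846) that the "`+`" ones have real part `> 1` and that
   roots "accumulate only at `±∞`": for any set `P ⊂ ℝ` of real parts with `P ⊂ (1, ∞)` and `P ∩ [1,2]` finite
   there is `ε ∈ (0,1]` with `P − 1 ⊂ [ε, ∞)`.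
6. (v3) `det_N2Lv`, `det_N2Lv1`: Lemma 8.4's own factorisations, proof items 4–5 (vector types `v1`, `v l`), as
   `ring` identities on the pure-type reductions of the printed operator eq. `EqWEOpMink0` — exact for `2L̂(0)`, up
   to `2^{-n}` for `L̂(0)` (`det_N2Lv1_half`); the scalar types (items 1–3: 4×4, 6×6, 7×7) are certified by the cell's
   two engines only (exact-rational and symbolic), not in the kernel.

Deliberately NOT here: the scalar-type indicial families of `L̂(0)` and the `s`-type ones of `□^𝓒(0)^`, the
`z`-Taylor expansions following l.6069, anything about `γ^Υ_{𝓗⁺}` or the 1-forms `𝔡^Υ`, and every analytic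
(Fredholm / mode-stability) statement.  Audit context: `run/shared/lean/pub/pub-kerr/HINTZ-PLAN.md` (P7 T5, P8 R8),
`ADEP.md` §D, `DIVERGENCE.md` SRC-A9.

## References
* P. Hintz, arXiv:2606.28253v2 (2026): Def 4.1 + footnote (p. 81, l.4142–4159), l.4173; Lemma 6.6 and its proof
  (p. 117, l.6041–6067), l.6069; Thm 7.1(3) (p. 136, l.6831), eq. `EqWCIndRoots` l.6837–6846; Lemma 8.4 and its
  proof (p. 149, l.7545–7611); printed pages = running heads of the v2 PDF.  Key `Hintz2026` (claim under
  review; only the printed matrices/lists are used).  v2 of this file (same day): locator corrections only;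
  v3: §6 (Lemma 8.4 proof items 4–5, vector types, in the kernel).
-/

noncomputable section

open Matrix

namespace Literature.Geometry.Lorentzian.Hintz2026.IndicialRoots

/-! ## 1. The printed indicial families and their determinants -/

/-- The scalar-type-`0` indicial family of `□^Υ_{g_b,E^Υ}(0)^` as printed in the proof of Lemma 6.6 (l.6059):
`N_{s0}(λ) = (−λ²+λ)·1 + [[1,−1],[−1,1]] + γ[[−(1+e)λ+2e, −(1−e)λ−2e],[(1−e)λ+2e, (1+e)λ−2e]]`, entries written out.
[cite: Hintz2026, proof of Lemma 6.6, TeX l.6059 (transcription; claim under review)] -/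
def Ns0 (e γ lam : ℝ) : Matrix (Fin 2) (Fin 2) ℝ :=
  !![-lam ^ 2 + lam + 1 + γ * (-(1 + e) * lam + 2 * e), -1 + γ * (-(1 - e) * lam - 2 * e);
     -1 + γ * ((1 - e) * lam + 2 * e), -lam ^ 2 + lam + 1 + γ * ((1 + e) * lam - 2 * e)]

/-- The scalar-type-`l` (`l ≥ 1`) indicial family as printed in the proof of Lemma 6.6 (l.6060–6061), with
`L` standing for `l(l+1)`:
`N_{s l}(λ) = (−λ²+λ)·1 + diag(L, L, L−1) + [[1,−1,−L],[−1,1,L],[−2,2,1]] + γ[[−(1+e)λ+2e, −(1−e)λ−2e, −eL],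
[(1−e)λ+2e, (1+e)λ−2e, −eL],[2,2,0]]`, entries written out (`L` is kept a free real parameter).
[cite: Hintz2026, proof of Lemma 6.6, TeX l.6060-6061 (transcription; claim under review)] -/
def Nsl (e γ L lam : ℝ) : Matrix (Fin 3) (Fin 3) ℝ :=
  !![-lam ^ 2 + lam + L + 1 + γ * (-(1 + e) * lam + 2 * e), -1 + γ * (-(1 - e) * lam - 2 * e), -L + γ * (-e * L);
     -1 + γ * ((1 - e) * lam + 2 * e), -lam ^ 2 + lam + L + 1 + γ * ((1 + e) * lam - 2 * e), L + γ * (-e * L);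
     -2 + γ * 2, 2 + γ * 2, -lam ^ 2 + lam + (L - 1) + 1]

/-- The vector-type-`l` (`l ≥ 1`) indicial family as printed (l.6062): `N_{v l}(λ) = −λ² + λ + l(l+1)` (a scalar).
[cite: Hintz2026, proof of Lemma 6.6, TeX l.6062 (transcription; claim under review)] -/
def Nvl (l lam : ℝ) : ℝ := -lam ^ 2 + lam + l * (l + 1)

/-- **Lemma 6.6, `s0` determinant.** `det N_{s0}(λ) = λ(λ−2)(λ² − (1 + 4eγ²))` for all real `e, γ, λ` — the claimed
roots `−λ^Υ_{s0,1}, 0, λ^Υ_{s0,1}, 2` with `(λ^Υ_{s0,1})² = 1 + 4e^Υ(γ^Υ)²`.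
[cite: Hintz2026, Lemma 6.6 (s0 roots), TeX l.6045 and l.6064] -/
theorem det_Ns0 (e γ lam : ℝ) :
    (Ns0 e γ lam).det = lam * (lam - 2) * (lam ^ 2 - (1 + 4 * e * γ ^ 2)) := by
  rw [Ns0, Matrix.det_fin_two_of]
  ring

/-- **Lemma 6.6, `s l` determinant.** For all real `e, γ, L, λ`:
`det N_{s l}(λ) = −(λ² − 3λ − L + 2)(λ⁴ − (2L + 1 + 4eγ²)λ² + L(L + 4eγ²))`; for `L = l(l+1)` the first factor is
`(λ + l − 1)(λ − l − 2)` (`det_Nsl'`). [cite: Hintz2026, Lemma 6.6 (s l roots), TeX l.6046 and l.6064] -/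
theorem det_Nsl (e γ L lam : ℝ) :
    (Nsl e γ L lam).det =
      -((lam ^ 2 - 3 * lam - L + 2) *
        (lam ^ 4 - (2 * L + 1 + 4 * e * γ ^ 2) * lam ^ 2 + L * (L + 4 * e * γ ^ 2))) := by
  simp [Nsl, Matrix.det_fin_three]
  ring

/-- `det_Nsl` with `L = l(l+1)`: `det N_{s l}(λ) = −(λ+l−1)(λ−l−2)(λ⁴ − (2l(l+1)+1+4eγ²)λ² + l(l+1)(l(l+1)+4eγ²))`.
[cite: Hintz2026, Lemma 6.6 (s l roots), TeX l.6046] -/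
theorem det_Nsl' (e γ l lam : ℝ) :
    (Nsl e γ (l * (l + 1)) lam).det =
      -((lam + l - 1) * (lam - l - 2) *
        (lam ^ 4 - (2 * (l * (l + 1)) + 1 + 4 * e * γ ^ 2) * lam ^ 2 +
          l * (l + 1) * (l * (l + 1) + 4 * e * γ ^ 2))) := by
  rw [det_Nsl]
  ring

/-- **Lemma 6.6, `v l`.** `N_{v l}(λ) = −(λ + l)(λ − (l+1))`: roots `−l, l+1`.
[cite: Hintz2026, Lemma 6.6 (v l roots), TeX l.6047] -/
theorem Nvl_eq (l lam : ℝ) : Nvl l lam = -((lam + l) * (lam - (l + 1))) := by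
  rw [Nvl]
  ring

/-! ## 2. The printed nested-radical roots -/

/-- `c(z) := ½ + 2z`, `z = e^Υ(γ^Υ)²` (the combination entering the printed roots, l.6051–6052). [folklore] -/
def cz (z : ℝ) : ℝ := 1 / 2 + 2 * z

/-- `(λ^Υ_{s l,l})² = L + ½ + 2z − √(L + (½+2z)²)` as printed (l.6051), `L = l(l+1)`.
[cite: Hintz2026, Lemma 6.6, TeX l.6051 (transcription; claim under review)] -/
def lamLoSq (z L : ℝ) : ℝ := L + cz z - Real.sqrt (L + cz z ^ 2)

/-- `(λ^Υ_{s l,l+1})² = L + ½ + 2z + √(L + (½+2z)²)` as printed (l.6052).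
[cite: Hintz2026, Lemma 6.6, TeX l.6052 (transcription; claim under review)] -/
def lamHiSq (z L : ℝ) : ℝ := L + cz z + Real.sqrt (L + cz z ^ 2)

/-- `λ^Υ_{s l,l} := ((λ^Υ_{s l,l})²)^{1/2}` (l.6051). [cite: Hintz2026, Lemma 6.6, TeX l.6051 (transcription)] -/
def lamLo (z L : ℝ) : ℝ := Real.sqrt (lamLoSq z L)

/-- `λ^Υ_{s l,l+1} := ((λ^Υ_{s l,l+1})²)^{1/2}` (l.6052). [cite: Hintz2026, Lemma 6.6, TeX l.6052 (transcription)] -/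
def lamHi (z L : ℝ) : ℝ := Real.sqrt (lamHiSq z L)

/-- The quartic factor of `det N_{s l}` is `(λ² − (λ_{l,l})²)(λ² − (λ_{l,l+1})²)` with the printed radicals, for
every `L ≥ 0` and every real `z`. [cite: Hintz2026, Lemma 6.6, TeX l.6046 and l.6051-6052] -/
theorem quartic_factor {L : ℝ} (hL : 0 ≤ L) (z lam : ℝ) :
    lam ^ 4 - (2 * L + 1 + 4 * z) * lam ^ 2 + L * (L + 4 * z) =
      (lam ^ 2 - lamLoSq z L) * (lam ^ 2 - lamHiSq z L) := by
  have hs : Real.sqrt (L + cz z ^ 2) ^ 2 = L + cz z ^ 2 := Real.sq_sqrt (by positivity)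
  simp only [lamLoSq, lamHiSq]
  have : (lam ^ 2 - (L + cz z - Real.sqrt (L + cz z ^ 2))) * (lam ^ 2 - (L + cz z + Real.sqrt (L + cz z ^ 2))) =
      (lam ^ 2 - (L + cz z)) ^ 2 - Real.sqrt (L + cz z ^ 2) ^ 2 := by ring
  rw [this, hs, cz]
  ring

/-- `0 ≤ (λ_{l,l})²` when `L ≥ 0`, `z ≥ 0` (so the printed real square root makes sense). [folklore] -/
theorem lamLoSq_nonneg {z L : ℝ} (hz : 0 ≤ z) (hL : 0 ≤ L) : 0 ≤ lamLoSq z L := by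
  simp only [lamLoSq, cz]
  have h1 : 0 ≤ L + (1 / 2 + 2 * z) := by positivity
  have h2 : Real.sqrt (L + (1 / 2 + 2 * z) ^ 2) ≤ L + (1 / 2 + 2 * z) := by
    rw [Real.sqrt_le_left h1]
    nlinarith
  linarith

/-- `0 ≤ (λ_{l,l+1})²` when `L ≥ 0`, `z ≥ 0`. [folklore] -/
theorem lamHiSq_nonneg {z L : ℝ} (hz : 0 ≤ z) (hL : 0 ≤ L) : 0 ≤ lamHiSq z L := by
  simp only [lamHiSq, cz]
  positivity

/-- `(λ_{l,l})² = λ_{l,l}·λ_{l,l}` etc.: the radicals square back (`L, z ≥ 0`). [folklore] -/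
theorem lamLo_sq {z L : ℝ} (hz : 0 ≤ z) (hL : 0 ≤ L) : lamLo z L ^ 2 = lamLoSq z L :=
  Real.sq_sqrt (lamLoSq_nonneg hz hL)

/-- See `lamLo_sq`. [folklore] -/
theorem lamHi_sq {z L : ℝ} (hz : 0 ≤ z) (hL : 0 ≤ L) : lamHi z L ^ 2 = lamHiSq z L :=
  Real.sq_sqrt (lamHiSq_nonneg hz hL)

/-- **Lemma 6.6, `s l` roots in closed form.** For `l ≥ 0`... precisely for `L = l(l+1)` with `l ≥ 0` real and
`z = eγ² ≥ 0`: `det N_{s l}(λ) = −(λ+l−1)(λ−l−2)(λ−λ_{l,l})(λ+λ_{l,l})(λ−λ_{l,l+1})(λ+λ_{l,l+1})`, i.e. the roots are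
exactly the printed six numbers `−λ_{l,l+1}, −λ_{l,l}, −l+1, λ_{l,l}, λ_{l,l+1}, l+2`.
[cite: Hintz2026, Lemma 6.6 (s l roots), TeX l.6046, l.6051-6052] -/
theorem det_Nsl_roots {e γ l : ℝ} (he : 0 ≤ e) (hl : 0 ≤ l) (lam : ℝ) :
    (Nsl e γ (l * (l + 1)) lam).det =
      -((lam + l - 1) * (lam - l - 2) *
        ((lam - lamLo (e * γ ^ 2) (l * (l + 1))) * (lam + lamLo (e * γ ^ 2) (l * (l + 1))) *
          ((lam - lamHi (e * γ ^ 2) (l * (l + 1))) * (lam + lamHi (e * γ ^ 2) (l * (l + 1)))))) := by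
  have hz : 0 ≤ e * γ ^ 2 := by positivity
  have hL : 0 ≤ l * (l + 1) := by positivity
  have h1 : (lam - lamLo (e * γ ^ 2) (l * (l + 1))) * (lam + lamLo (e * γ ^ 2) (l * (l + 1))) =
      lam ^ 2 - lamLoSq (e * γ ^ 2) (l * (l + 1)) := by
    rw [← lamLo_sq hz hL]; ring
  have h2 : (lam - lamHi (e * γ ^ 2) (l * (l + 1))) * (lam + lamHi (e * γ ^ 2) (l * (l + 1))) =
      lam ^ 2 - lamHiSq (e * γ ^ 2) (l * (l + 1)) := by
    rw [← lamHi_sq hz hL]; ring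
  rw [h1, h2, ← quartic_factor hL, det_Nsl']
  ring

/-- **"In particular, `λ^Υ_{s0,1} = √(1 + 4e^Υ(γ^Υ)²)`"** (l.6054): at `L = 0` the upper radical is
`(λ_{0,1})² = 1 + 4z` (and the lower one is `0`), for `z ≥ −1/4`… stated for `z ≥ 0`.
[cite: Hintz2026, Lemma 6.6 ("In particular"), TeX l.6054] -/
theorem lamHiSq_zero {z : ℝ} (hz : 0 ≤ z) : lamHiSq z 0 = 1 + 4 * z ∧ lamLoSq z 0 = 0 := by
  have hc : 0 ≤ cz z := by simp only [cz]; positivity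
  have h : Real.sqrt (0 + cz z ^ 2) = cz z := by rw [zero_add, Real.sqrt_sq hc]
  refine ⟨?_, ?_⟩
  · rw [lamHiSq, h, cz]; ring
  · rw [lamLoSq, h]; ring

/-- `λ^Υ_{s0,1} = √(1+4z)` squares to `1 + 4z` and `det N_{s0}` factors over it:
`det N_{s0}(λ) = λ(λ−2)(λ − √(1+4z))(λ + √(1+4z))`, `z = eγ² ≥ 0`. [cite: Hintz2026, Lemma 6.6 (s0 roots), TeX l.6045, l.6054] -/
theorem det_Ns0_roots {e γ : ℝ} (he : 0 ≤ e) (lam : ℝ) :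
    (Ns0 e γ lam).det =
      lam * (lam - 2) * ((lam - Real.sqrt (1 + 4 * (e * γ ^ 2))) * (lam + Real.sqrt (1 + 4 * (e * γ ^ 2)))) := by
  have hz : 0 ≤ 1 + 4 * (e * γ ^ 2) := by positivity
  have hs : Real.sqrt (1 + 4 * (e * γ ^ 2)) ^ 2 = 1 + 4 * (e * γ ^ 2) := Real.sq_sqrt hz
  rw [det_Ns0]
  have : (lam - Real.sqrt (1 + 4 * (e * γ ^ 2))) * (lam + Real.sqrt (1 + 4 * (e * γ ^ 2))) =
      lam ^ 2 - Real.sqrt (1 + 4 * (e * γ ^ 2)) ^ 2 := by ring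
  rw [this, hs]
  ring

/-! ## 3. Location of the roots (`l ≥ 1`, `z ≥ 0`) and the signs used by Lemma 8.4 -/

/-- `l ≤ λ_{l,l}` for `l ≥ 0`, `z ≥ 0` (with equality iff `z = 0`: `lamLo_eq_iff`). [folklore] -/
theorem le_lamLo {z l : ℝ} (hz : 0 ≤ z) (hl : 0 ≤ l) : l ≤ lamLo z (l * (l + 1)) := by
  have hL : 0 ≤ l * (l + 1) := by positivity
  rw [lamLo]
  apply Real.le_sqrt_of_sq_le
  -- `l² ≤ L + c − √(L + c²)` ⟺ `√(L+c²) ≤ l + c` ⟸ `L + c² ≤ (l+c)²` ⟺ `l ≤ 2lc` ⟸ `c ≥ 1/2`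
  simp only [lamLoSq, cz]
  have hc : 0 ≤ l + (1 / 2 + 2 * z) := by positivity
  have key : Real.sqrt (l * (l + 1) + (1 / 2 + 2 * z) ^ 2) ≤ l + (1 / 2 + 2 * z) := by
    rw [Real.sqrt_le_left hc]
    nlinarith
  nlinarith

/-- `λ_{l,l} < l + 1` for `l ≥ 0` and every real `z` with `z ≥ 0`. [folklore] -/
theorem lamLo_lt {z l : ℝ} (hz : 0 ≤ z) (hl : 0 ≤ l) : lamLo z (l * (l + 1)) < l + 1 := by
  have hL : 0 ≤ l * (l + 1) := by positivity
  rw [lamLo, Real.sqrt_lt (lamLoSq_nonneg hz hL) (by positivity)]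
  simp only [lamLoSq, cz]
  -- `L + c − √(L+c²) < (l+1)²` ⟺ `c − (l+1) < √(L + c²)`, true since `√(L+c²) ≥ c > c − (l+1)`
  have h1 : (1 / 2 + 2 * z) ≤ Real.sqrt (l * (l + 1) + (1 / 2 + 2 * z) ^ 2) :=
    Real.le_sqrt_of_sq_le (by nlinarith)
  nlinarith

/-- `l + 1 ≤ λ_{l,l+1}` for `l ≥ 0`, `z ≥ 0` (equality iff `z = 0`). [folklore] -/
theorem le_lamHi {z l : ℝ} (hz : 0 ≤ z) (hl : 0 ≤ l) : l + 1 ≤ lamHi z (l * (l + 1)) := by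
  have hL : 0 ≤ l * (l + 1) := by positivity
  rw [lamHi]
  apply Real.le_sqrt_of_sq_le
  simp only [lamHiSq, cz]
  -- `(l+1)² ≤ L + c + √(L+c²)` ⟺ `l + 1 − c ≤ √(L+c²)`
  by_cases h : l + 1 - (1 / 2 + 2 * z) ≤ 0
  · have := Real.sqrt_nonneg (l * (l + 1) + (1 / 2 + 2 * z) ^ 2)
    nlinarith
  · rw [not_le] at h
    have key : l + 1 - (1 / 2 + 2 * z) ≤ Real.sqrt (l * (l + 1) + (1 / 2 + 2 * z) ^ 2) :=
      Real.le_sqrt_of_sq_le (by nlinarith)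
    nlinarith

/-- `λ_{l,l} < λ_{l,l+1}` (the radical is strictly positive as soon as `L + c² > 0`, in particular for
`z ≥ 0`). [folklore] -/
theorem lamLo_lt_lamHi {z L : ℝ} (hz : 0 ≤ z) (hL : 0 ≤ L) : lamLo z L < lamHi z L := by
  rw [lamLo, lamHi]
  apply Real.sqrt_lt_sqrt (lamLoSq_nonneg hz hL)
  simp only [lamLoSq, lamHiSq]
  have : 0 < Real.sqrt (L + cz z ^ 2) := by
    apply Real.sqrt_pos.2
    have : 0 < cz z := by simp only [cz]; positivity
    positivity
  linarith

/-- `0 ≤ λ_{l,l}` and `0 < λ_{l,l+1}` (`L, z ≥ 0`). [folklore] -/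
theorem lamLo_nonneg_lamHi_pos {z L : ℝ} (hz : 0 ≤ z) (hL : 0 ≤ L) : 0 ≤ lamLo z L ∧ 0 < lamHi z L := by
  refine ⟨Real.sqrt_nonneg _, ?_⟩
  rw [lamHi]
  apply Real.sqrt_pos.2
  simp only [lamHiSq]
  have : 0 < Real.sqrt (L + cz z ^ 2) := by
    apply Real.sqrt_pos.2
    have : 0 < cz z := by simp only [cz]; positivity
    positivity
  have : 0 ≤ cz z := by simp only [cz]; positivity
  linarith

/-- **Sign used by Lemma 8.4.** `1 − λ^Υ_{s l,l} ≤ 0` for `l ≥ 1`, `z ≥ 0`: the Lemma-8.4 `s l` entry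
"`−λ^Υ_{s l,l}+1`" (l.7550, l.7552) has non-positive real part, as the counting clause of Lemma 8.4 (l.7561)
requires. [cite: Hintz2026, Lemma 8.4 (s l roots, counting clause), TeX l.7550-7561] -/
theorem one_sub_lamLo_nonpos {z l : ℝ} (hz : 0 ≤ z) (hl : 1 ≤ l) : 1 - lamLo z (l * (l + 1)) ≤ 0 := by
  have := le_lamLo hz (by linarith : (0 : ℝ) ≤ l)
  linarith

/-- `1 − λ^Υ_{s0,1} = 1 − √(1+4z) ≤ 0` for `z ≥ 0`, `< 0` iff `z > 0`. [folklore] -/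
theorem one_sub_sqrt_nonpos {z : ℝ} (hz : 0 ≤ z) : 1 - Real.sqrt (1 + 4 * z) ≤ 0 := by
  have : 1 ≤ Real.sqrt (1 + 4 * z) := Real.le_sqrt_of_sq_le (by linarith)
  linarith

/-- **Lemma 8.4's `s0` list and the role of `e^Υ > 0`.** In Lemma 8.4 (l.7549) the `s0` roots of `L̂(0)` include
"`−λ^Υ_{s0,1}+1`" (from Lemma 6.6, shifted by `+1`) and "`0`" (from the `𝓒`-root `1` of eq. `EqWCIndRoots` l.6840, shifted
by `−1`).  These two COINCIDE iff `z = e^Υ(γ^Υ)² = 0`; so the simplicity clause of Lemma 8.4 uses `e^Υγ^Υ ≠ 0` — the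
standing choice "`e^Υ, γ^Υ, γ^Υ_{𝓗⁺} > 0` small" of Def 4.1 (footnote, l.4144) and the purpose stated at l.4173
("to remove integer coincidences in indicial roots of zero energy operators"), not restated in the lemma.
[cite: Hintz2026, Lemma 8.4 (s0 roots), TeX l.7549; Def 4.1 footnote l.4144; l.4173] -/
theorem lemma84_s0_coincide_iff {z : ℝ} (hz : 0 ≤ z) : 1 - Real.sqrt (1 + 4 * z) = 0 ↔ z = 0 := by
  constructor
  · intro h
    have h1 : Real.sqrt (1 + 4 * z) = 1 := by linarith
    have h2 : 1 + 4 * z = 1 := by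
      have := Real.sq_sqrt (show (0 : ℝ) ≤ 1 + 4 * z by linarith)
      rw [h1] at this; linarith
    linarith
  · rintro rfl
    simp

/-- The explicitly printed (non-`𝓒`) `s l` roots of Lemma 8.4 (l.7552–7553, `l ≥ 2`; Lemma 6.6's roots `+1`, and
`−l, l+1` from the factor `(λ+l)(λ−l−1)` of item 3 of the proof, l.7594) all avoid the open interval `(0,1)`:
`1−λ_{l,l+1} ≤ −l`, `−l`, `1−λ_{l,l} ≤ 1−l`, `2−l ≤ 0` are `≤ 0` and `l+1`, `1+λ_{l,l} ≥ l+1`, `1+λ_{l,l+1} ≥ l+2`,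
`l+3` are `≥ 1` (`z ≥ 0`).  Four on each side, matching the counting clause (l.7561) once the three `𝓒,≪` and three
`𝓒,+` roots (eq. `EqWCIndRoots` l.6842) are added to the respective sides. [cite: Hintz2026, Lemma 8.4 (s l roots), TeX l.7552-7553, 7594] -/
theorem lemma84_sl_explicit_roots_avoid_gap {z l : ℝ} (hz : 0 ≤ z) (hl : 2 ≤ l) :
    (1 - lamHi z (l * (l + 1)) ≤ 0 ∧ -l ≤ 0 ∧ 1 - lamLo z (l * (l + 1)) ≤ 0 ∧ -l + 2 ≤ 0) ∧
      (1 ≤ l + 1 ∧ 1 ≤ 1 + lamLo z (l * (l + 1)) ∧ 1 ≤ 1 + lamHi z (l * (l + 1)) ∧ 1 ≤ l + 3) := by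
  have hl0 : (0 : ℝ) ≤ l := by linarith
  have h1 := le_lamLo hz hl0
  have h2 := le_lamHi hz hl0
  refine ⟨⟨by linarith, by linarith, by linarith, by linarith⟩, by linarith, by linarith, by linarith, by linarith⟩

/-- Same for the `s1` line of Lemma 8.4 (l.7550–7551): `1−λ_{1,2} ≤ −1`, `−1`, `1−λ_{1,1} ≤ 0` vs
`2`, `1+λ_{1,1} ≥ 2`, `1+λ_{1,2} ≥ 3`, `4` — three and four explicit roots, completed to six and six by the
`𝓒,≪` (three) and `𝓒,+` (two) roots of eq. `EqWCIndRoots` l.6841. [cite: Hintz2026, Lemma 8.4 (s1 roots), TeX l.7550-7551] -/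
theorem lemma84_s1_explicit_roots_avoid_gap {z : ℝ} (hz : 0 ≤ z) :
    (1 - lamHi z (1 * (1 + 1)) ≤ 0 ∧ (-1 : ℝ) ≤ 0 ∧ 1 - lamLo z (1 * (1 + 1)) ≤ 0) ∧
      ((1 : ℝ) ≤ 2 ∧ 1 ≤ 1 + lamLo z (1 * (1 + 1)) ∧ 1 ≤ 1 + lamHi z (1 * (1 + 1)) ∧ (1 : ℝ) ≤ 4) := by
  have h1 := le_lamLo hz (zero_le_one : (0 : ℝ) ≤ 1)
  have h2 := le_lamHi hz (zero_le_one : (0 : ℝ) ≤ 1)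
  refine ⟨⟨by linarith, by norm_num, by linarith⟩, by norm_num, by linarith, by linarith, by norm_num⟩

/-! ## 4. Simplicity: exact range -/

/-- `λ_{l,l+1} < l + 2` as long as `z < (l+1)(2l+3)/(3l+4)`; in particular for all `l ≥ 1` when `z < 10/7`
(`z ≥ 0`). [folklore] -/
theorem lamHi_lt_of_lt {z l : ℝ} (hz : 0 ≤ z) (hl : 1 ≤ l) (hz' : z < 10 / 7) :
    lamHi z (l * (l + 1)) < l + 2 := by
  have hL : 0 ≤ l * (l + 1) := by nlinarith
  rw [lamHi, Real.sqrt_lt (lamHiSq_nonneg hz hL) (by linarith)]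
  simp only [lamHiSq, cz]
  have hy : 0 ≤ l * (l + 1) + (1 / 2 + 2 * z) ^ 2 := add_nonneg hL (sq_nonneg _)
  -- `√(L + c²) < 3l + 4 − c` with `c = 1/2 + 2z < 7/2 ≤ 3l + 4`
  have hpos : 0 < 3 * l + 4 - (1 / 2 + 2 * z) := by linarith
  have key : Real.sqrt (l * (l + 1) + (1 / 2 + 2 * z) ^ 2) < 3 * l + 4 - (1 / 2 + 2 * z) := by
    rw [Real.sqrt_lt hy hpos.le]
    -- ⟺ `4z(3l+4) < 8l² + 20l + 12`, implied by `z < 10/7 ≤ (2l²+5l+3)/(3l+4)` (as `14l²+5l−19 ≥ 0` for `l ≥ 1`)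
    nlinarith
  linarith

/-- The coincidence value: `λ_{l,l+1} = l + 2` exactly when `z = (l+1)(2l+3)/(3l+4)` (`l ≥ 1`); e.g. `l = 1`,
`z = 10/7`. Stated as: at that `z`, `(λ_{l,l+1})² = (l+2)²`. [folklore] -/
theorem lamHiSq_eq_at_coincidence {l : ℝ} (hl : 1 ≤ l) :
    lamHiSq ((l + 1) * (2 * l + 3) / (3 * l + 4)) (l * (l + 1)) = (l + 2) ^ 2 := by
  have h34 : 0 < 3 * l + 4 := by linarith
  simp only [lamHiSq, cz]
  -- with `c = 1/2 + 2z = (8l²+23l+16)/(6l+8)`, `√(L + c²) = 3l+4−c ≥ 0`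
  have hc : 1 / 2 + 2 * ((l + 1) * (2 * l + 3) / (3 * l + 4)) = (8 * l ^ 2 + 23 * l + 16) / (6 * l + 8) := by
    field_simp
    ring
  rw [hc]
  have hnn : 0 ≤ 3 * l + 4 - (8 * l ^ 2 + 23 * l + 16) / (6 * l + 8) := by
    rw [sub_nonneg, div_le_iff₀ (by linarith)]
    nlinarith
  have hs : Real.sqrt (l * (l + 1) + ((8 * l ^ 2 + 23 * l + 16) / (6 * l + 8)) ^ 2) =
      3 * l + 4 - (8 * l ^ 2 + 23 * l + 16) / (6 * l + 8) := by
    rw [Real.sqrt_eq_iff_eq_sq (by positivity) hnn]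
    field_simp
    ring
  rw [hs]
  ring

/-- **Lemma 6.6, simplicity of the `s l` roots — exact range.** For `l ≥ 1` and `0 ≤ z < 10/7` the six printed
`s l` roots `−λ_{l,l+1} < −λ_{l,l} < −l+1 < λ_{l,l} < λ_{l,l+1} < l+2` are strictly increasing, hence pairwise
distinct. [cite: Hintz2026, Lemma 6.6 ("All indicial roots … are simple", s l), TeX l.6043-6046] -/
theorem sl_roots_strictMono {z l : ℝ} (hz : 0 ≤ z) (hl : 1 ≤ l) (hz' : z < 10 / 7) :
    -lamHi z (l * (l + 1)) < -lamLo z (l * (l + 1)) ∧ -lamLo z (l * (l + 1)) < -l + 1 ∧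
      -l + 1 < lamLo z (l * (l + 1)) ∧ lamLo z (l * (l + 1)) < lamHi z (l * (l + 1)) ∧
        lamHi z (l * (l + 1)) < l + 2 := by
  have hl0 : (0 : ℝ) ≤ l := by linarith
  have hL : 0 ≤ l * (l + 1) := by positivity
  have h1 := le_lamLo hz hl0
  have h3 := lamLo_lt_lamHi hz hL
  have h4 := lamHi_lt_of_lt hz hl hz'
  exact ⟨by linarith, by linarith, by linarith, h3, h4⟩

/-- **Lemma 6.6, simplicity of the `s0` roots — exact range.** For `z ≥ 0`, `z ≠ 3/4` the four `s0` roots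
`−√(1+4z) < 0 < √(1+4z) ≠ 2` are pairwise distinct (and at `z = 3/4`, `√(1+4z) = 2`: `det_Ns0_double_root`).
[cite: Hintz2026, Lemma 6.6 ("All indicial roots … are simple", s0), TeX l.6043-6045] -/
theorem s0_roots_pairwise_ne {z : ℝ} (hz : 0 ≤ z) (hz' : z ≠ 3 / 4) :
    -Real.sqrt (1 + 4 * z) < 0 ∧ 0 < Real.sqrt (1 + 4 * z) ∧ Real.sqrt (1 + 4 * z) ≠ 2 ∧
      -Real.sqrt (1 + 4 * z) ≠ 2 := by
  have hpos : 0 < Real.sqrt (1 + 4 * z) := Real.sqrt_pos.2 (by linarith)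
  refine ⟨by linarith, hpos, ?_, by linarith⟩
  intro h
  have : 1 + 4 * z = 4 := by
    have := Real.sq_sqrt (show (0 : ℝ) ≤ 1 + 4 * z by linarith)
    rw [h] at this; linarith
  exact hz' (by linarith)

/-- **Lemma 6.6, `v l` roots are simple:** `−l ≠ l + 1` (`l ≥ 0`). [cite: Hintz2026, Lemma 6.6 (v l), TeX l.6047] -/
theorem vl_roots_ne {l : ℝ} (hl : 0 ≤ l) : (-l : ℝ) ≠ l + 1 := by
  intro h; linarith

/-- **All printed roots of Lemma 6.6 are simple whenever `0 ≤ e^Υ(γ^Υ)² < 3/4`** (all types, all `l ≥ 1`):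
the `s l` chain is strictly increasing, the `s0` four are distinct, the `v l` two are distinct.  This is the
regime the paper works in ("for small `e^Υ` and `γ^Υ`", l.6069; Def 4.1 footnote l.4144).
[cite: Hintz2026, Lemma 6.6 ("All indicial roots … are simple"), TeX l.6043] -/
theorem all_simple_of_lt {e γ : ℝ} (he : 0 ≤ e) (hz : e * γ ^ 2 < 3 / 4) {l : ℝ} (hl : 1 ≤ l) :
    (-lamHi (e * γ ^ 2) (l * (l + 1)) < -lamLo (e * γ ^ 2) (l * (l + 1)) ∧
        -lamLo (e * γ ^ 2) (l * (l + 1)) < -l + 1 ∧ -l + 1 < lamLo (e * γ ^ 2) (l * (l + 1)) ∧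
          lamLo (e * γ ^ 2) (l * (l + 1)) < lamHi (e * γ ^ 2) (l * (l + 1)) ∧
            lamHi (e * γ ^ 2) (l * (l + 1)) < l + 2) ∧
      (-Real.sqrt (1 + 4 * (e * γ ^ 2)) < 0 ∧ 0 < Real.sqrt (1 + 4 * (e * γ ^ 2)) ∧
          Real.sqrt (1 + 4 * (e * γ ^ 2)) ≠ 2 ∧ -Real.sqrt (1 + 4 * (e * γ ^ 2)) ≠ 2) ∧
        (-l : ℝ) ≠ l + 1 := by
  have hz0 : 0 ≤ e * γ ^ 2 := by positivity
  exact ⟨sl_roots_strictMono hz0 hl (by linarith), s0_roots_pairwise_ne hz0 (by linarith),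
    vl_roots_ne (by linarith)⟩

/-- **The unqualified sentence fails, I.** At `e^Υ(γ^Υ)² = 3/4`: `det N_{s0}(λ) = λ(λ−2)²(λ+2)` — the root
`2 = λ^Υ_{s0,1}` is DOUBLE.  (Outside the paper's small-parameter regime; recorded so that the typed statement of
Lemma 6.6 carries the hypothesis the printed one leaves implicit.) [cite: Hintz2026, Lemma 6.6 (s0), TeX l.6043-6045] -/
theorem det_Ns0_double_root {e γ : ℝ} (h : e * γ ^ 2 = 3 / 4) (lam : ℝ) :
    (Ns0 e γ lam).det = lam * (lam - 2) ^ 2 * (lam + 2) := by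
  rw [det_Ns0]
  have : 1 + 4 * e * γ ^ 2 = 4 := by linear_combination 4 * h
  rw [this]
  ring

/-- **The unqualified sentence fails, II.** At `e^Υ(γ^Υ)² = 10/7` and `l = 1` (`L = 2`):
`det N_{s1}(λ) = −λ(λ−3)²(λ+3)(λ² − 12/7)` — the root `3 = l+2 = λ^Υ_{s1,2}` is DOUBLE.
[cite: Hintz2026, Lemma 6.6 (s l), TeX l.6043-6046] -/
theorem det_Ns1_double_root {e γ : ℝ} (h : e * γ ^ 2 = 10 / 7) (lam : ℝ) :
    (Nsl e γ 2 lam).det = -(lam * (lam - 3) ^ 2 * (lam + 3) * (lam ^ 2 - 12 / 7)) := by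
  rw [det_Nsl]
  have : 4 * e * γ ^ 2 = 40 / 7 := by linear_combination 4 * h
  have h2 : (2 * (2 : ℝ) + 1 + 4 * e * γ ^ 2) = 75 / 7 := by linarith
  have h3 : (2 : ℝ) * (2 + 4 * e * γ ^ 2) = 108 / 7 := by nlinarith
  rw [h2, h3]
  ring

/-! ## 5. The indicial gap `ε_ind` of Lemma 8.4: the bookkeeping behind "In particular, there is `ε_ind > 0`" -/

/-- **`ε_ind` exists (bookkeeping).**  By items 3–4 the explicitly printed roots of Lemma 8.4 avoid `(0,1)`; the
remaining ones are `λ^𝓒 − 1` for the `𝓒`-superscript indicial roots of eq. `EqWCIndRoots` (l.6837–6846), of which the "`≪`" ones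
have real part `< −C₀` (so `< 0` after the shift) and the "`+`" ones real part `> 1`; [CD] Thm M0 as recalled in
Thm 7.1(3) (l.6831) adds that the roots "accumulate only at `±∞`".  Reading the latter as local finiteness of the set
`P` of real parts: if `P ⊂ (1,∞)` and `P ∩ [1,2]` is finite, then some `ε ∈ (0,1]` has `x − 1 ≥ ε` for all `x ∈ P`
— so `(0, ε)` contains no real part of any root.  Pure order bookkeeping; the inputs are the cited statements.
[cite: Hintz2026, Lemma 8.4 ("In particular … ε_ind > 0"), TeX l.7557-7561; Thm 7.1(3) l.6831; l.6846] -/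
theorem epsInd_exists (P : Set ℝ) (hP : ∀ x ∈ P, 1 < x) (hfin : (P ∩ Set.Icc 1 2).Finite) :
    ∃ ε : ℝ, 0 < ε ∧ ε ≤ 1 ∧ ∀ x ∈ P, ε ≤ x - 1 := by
  by_cases hne : (P ∩ Set.Icc 1 2).Nonempty
  · -- take `ε = min 1 (m − 1)`, `m` = the least element of the finite nonempty set `P ∩ [1,2]`
    have hne' : hfin.toFinset.Nonempty := by
      obtain ⟨x, hx⟩ := hne
      exact ⟨x, hfin.mem_toFinset.2 hx⟩
    have hmmem : hfin.toFinset.min' hne' ∈ P ∩ Set.Icc 1 2 :=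
      hfin.mem_toFinset.1 (hfin.toFinset.min'_mem hne')
    refine ⟨min 1 (hfin.toFinset.min' hne' - 1), ?_, min_le_left _ _, ?_⟩
    · exact lt_min one_pos (by linarith [hP _ hmmem.1])
    · intro x hx
      by_cases hx2 : x ≤ 2
      · have hxmem : x ∈ hfin.toFinset := hfin.mem_toFinset.2 ⟨hx, (hP x hx).le, hx2⟩
        have := hfin.toFinset.min'_le x hxmem
        exact le_trans (min_le_right _ _) (by linarith)
      · rw [not_le] at hx2
        exact le_trans (min_le_left _ _) (by linarith)
  · refine ⟨1, one_pos, le_rfl, fun x hx => ?_⟩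
    by_contra h
    rw [not_le] at h
    exact hne ⟨x, hx, (hP x hx).le, by linarith⟩

/-! ## 6. Lemma 8.4, proof items 4–5 (vector types) in the kernel: the reduced indicial families of `2·L̂(0)`

The Minkowskian linearised gauge-fixed Einstein operator is printed as `2\hat{\ubar L}(0) = \hat{\ubar□}(0) + γ^𝓒 A +
γ^Υ B + γ^𝓒γ^Υ C` (eq. `EqWEOpMink0`, l.7326–7353, over the symmetric-2-tensor wave operator of eq. `EqTYMinkOpBox2`,
l.3313).  On VECTOR-type-`l` tensors `(0, 0, c𝕍, 0, f𝕍, 0, q δ̸*𝕍)` (eq. `EqTYSplit2`, l.3345–3346) only the blocks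
`(0∠, 1∠, ∠∠)` survive, every `d̸`/`g̸`/`s̸tr` entry and every divergence of `𝕍` drops out (`𝕍` is divergence-free),
and the identities `EqTYIdentities` (l.3209: `Δ̸𝕍 = (L−1)𝕍`, `δ̸δ̸*𝕍 = ((L−2)/2)𝕍`, `Δ̸δ̸*𝕍 = (L−4)δ̸*𝕍`, `L = l(l+1)`)
reduce the printed operator matrices to the explicit `3 × 3` (resp. `2 × 2` for `l = 1`, where `δ̸*𝕍 = 0`) polynomial
matrices `N2Lv`/`N2Lv1` below (the reduction itself — which block entries survive and with which eigenvalue — is the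
audit cell's, re-derived independently from the primitive operators of Lemma `LemmaTYMinkOp` by two engines,
`b2b-kerr-adep1/g4/weind_engine.py` (exact rational) and `weind_engineB_sympy.py` (symbolic); both also confirm the
scalar types `s0` (4×4), `s1` (6×6), `s l` (7×7), which are not repeated in the kernel).  What the kernel then checks is
Lemma 8.4's printed factorisations, items 4 and 5 of its proof (l.7597–7608), in the normalisation in which they hold
EXACTLY — for `2L̂(0)`; for `L̂(0)` itself, as printed ("`det N_{v l}(L̂(0), λ)`"), both sides differ by the constant
factor `2^{-n}`, `n` = size of the block (`det_N2Lv1_half`), which is immaterial for the root lists. -/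

/-- `N_{v l}(ρ^{-2}·2\hat{\ubar L}(0), λ)`, `l ≥ 2`, `L = l(l+1)`, in the slots `(c, f, q)` of `(0∠, 1∠, ∠∠ = qδ̸*𝕍)`:
`\hat{\ubar□}(0)`-part `diag(−λ²+λ+L−1, −λ²+λ+L−1, −λ²+λ+L−4) + [[3,−2,−(L−2)/2],[−2,3,(L−2)/2],[−4,4,2]]`,
`γ^𝓒`-part `[[(1−v)(λ−3), −(1−v)(λ−3), (1−v)(L−2)/2],[(1+v)(λ−3), −(1+v)(λ−3), (1+v)(L−2)/2],[0,0,0]]`,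
`γ^Υ`-part `[[−(λ+2), −(λ+2), 0],[λ+2, λ+2, 0],[4,4,0]]`, `γ^𝓒γ^Υ`-part `[[2(1−v),2(1−v),0],[2(1+v),2(1+v),0],[0,0,0]]`
(`v = v^𝓒`; `e^𝓒, e^Υ` do not enter the vector sector).
[cite: Hintz2026, eq. `EqWEOpMink0` l.7326-7353 and `EqTYMinkOpBox2` l.3313, reduced on vector type l via `EqTYIdentities` l.3209 (transcription + reduction; claim under review)] -/
def N2Lv (v γC γU L lam : ℝ) : Matrix (Fin 3) (Fin 3) ℝ :=
  !![-lam ^ 2 + lam + (L - 1) + 3 + γC * ((1 - v) * (lam - 3)) + γU * (-(lam + 2)) + γC * γU * (2 * (1 - v)),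
      -2 + γC * (-(1 - v) * (lam - 3)) + γU * (-(lam + 2)) + γC * γU * (2 * (1 - v)),
      -(L - 2) / 2 + γC * ((1 - v) * (L - 2) / 2);
    -2 + γC * ((1 + v) * (lam - 3)) + γU * (lam + 2) + γC * γU * (2 * (1 + v)),
      -lam ^ 2 + lam + (L - 1) + 3 + γC * (-(1 + v) * (lam - 3)) + γU * (lam + 2) + γC * γU * (2 * (1 + v)),
      (L - 2) / 2 + γC * ((1 + v) * (L - 2) / 2);
    -4 + γU * 4, 4 + γU * 4, -lam ^ 2 + lam + (L - 4) + 2]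

/-- `N_{v 1}(ρ^{-2}·2\hat{\ubar L}(0), λ)` in the slots `(c, f)` (for `l = 1`, `δ̸*𝕍 = 0`: the `∠∠` slot is absent;
`L = 2`). [cite: Hintz2026, eq. `EqWEOpMink0` l.7326-7353 reduced on vector type 1 (transcription + reduction; claim under review)] -/
def N2Lv1 (v γC γU lam : ℝ) : Matrix (Fin 2) (Fin 2) ℝ :=
  !![-lam ^ 2 + lam + 1 + 3 + γC * ((1 - v) * (lam - 3)) + γU * (-(lam + 2)) + γC * γU * (2 * (1 - v)),
      -2 + γC * (-(1 - v) * (lam - 3)) + γU * (-(lam + 2)) + γC * γU * (2 * (1 - v));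
    -2 + γC * ((1 + v) * (lam - 3)) + γU * (lam + 2) + γC * γU * (2 * (1 + v)),
      -lam ^ 2 + lam + 1 + 3 + γC * (-(1 + v) * (lam - 3)) + γU * (lam + 2) + γC * γU * (2 * (1 + v))]

/-- `N_{v l}(ρ^{-2}\hat{\ubar□}^𝓒_{\ubar E^𝓒}(0), λ) = −λ² + λ + L + γ^𝓒 v^𝓒 (4 − 2λ)`: the vector-type indicial
polynomial of the constraint damping operator, from eq. `EqWCRecBox0` (l.6804–6816: only `q_{∠∠} = −2v^𝓒ρ∂_ρ + 4v^𝓒`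
survives) over the 1-form wave operator of Lemma `LemmaTYMinkOp`(1).  For `l = 1` its roots are `−1 − 2v^𝓒γ^𝓒` and `2`
(`NvC_one`), as printed in eq. `EqWCIndRoots` (l.6843). [cite: Hintz2026, eq. `EqWCRecBox0` l.6804-6816; eq. `EqWCIndRoots` l.6843] -/
def NvC (v γC L lam : ℝ) : ℝ := -lam ^ 2 + lam + L + γC * v * (4 - 2 * lam)

/-- eq. `EqWCIndRoots`, `v1` line (l.6843): the `v 1` roots of `□^𝓒` are `−1 − 2v^𝓒γ^𝓒` and `2`.
[cite: Hintz2026, eq. `EqWCIndRoots` (v1), TeX l.6843] -/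
theorem NvC_one (v γC lam : ℝ) : NvC v γC 2 lam = -((lam - 2) * (lam + 1 + 2 * v * γC)) := by
  rw [NvC]; ring

/-- **Lemma 8.4, proof item 5 (`v l`, `l ≥ 2`), in the kernel** (l.7603–7608):
`−det N_{v l}(2L̂(0), λ) = (λ + l)(λ − l − 1) · N_{v l}(□^Υ, λ−1) · N_{v l}(□^𝓒, λ+1)` with `N_{v l}(□^Υ, μ) = −μ²+μ+l(l+1)`
(Lemma 6.6) — an identity in `(λ, l, v^𝓒, γ^𝓒, γ^Υ)`; hence the `v l` roots of `L̂(0)` are `−l, l+1`, the `□^Υ`-roots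
`+1` (`−l+1, l+2`) and the `□^𝓒`-roots `−1`, exactly the printed `v l` line of Lemma 8.4 (l.7555).  (For `L̂(0)` in place
of `2L̂(0)` both sides differ by `2^{-3}`.) [cite: Hintz2026, Lemma 8.4 proof item 5, TeX l.7603-7608; Lemma 8.4 (v l roots) l.7555] -/
theorem det_N2Lv (v γC γU l lam : ℝ) :
    -(N2Lv v γC γU (l * (l + 1)) lam).det =
      (lam + l) * (lam - l - 1) * Nvl l (lam - 1) * NvC v γC (l * (l + 1)) (lam + 1) := by
  simp [N2Lv, Nvl, NvC, Matrix.det_fin_three]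
  ring

/-- **Lemma 8.4, proof item 4 (`v 1`), in the kernel** (l.7597–7602):
`det N_{v1}(2L̂(0), λ) = (λ+1)(λ−2) · [λ^{-1}N_{v1}(□^Υ, λ−1)] · [(λ−1)^{-1}N_{v1}(□^𝓒, λ+1)] = (λ+1)(λ−2)(λ−3)(λ+2+2v^𝓒γ^𝓒)`
(the two bracketed quotients are the polynomials `−(λ−3)` and `−(λ+2+2v^𝓒γ^𝓒)`); the `v1` roots of `L̂(0)` are thus
`−2−2v^𝓒γ^𝓒 = λ^𝓒_{v1,≪}−1, −1, 2, 3` as printed (l.7554). (For `L̂(0)` itself: factor `2^{-2}`, `det_N2Lv1_half`.)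
[cite: Hintz2026, Lemma 8.4 proof item 4, TeX l.7597-7602; Lemma 8.4 (v1 roots) l.7554] -/
theorem det_N2Lv1 (v γC γU lam : ℝ) :
    (N2Lv1 v γC γU lam).det = (lam + 1) * (lam - 2) * (lam - 3) * (lam + 2 + 2 * v * γC) := by
  rw [N2Lv1, Matrix.det_fin_two_of]
  ring

/-- The quotients in item 4 are polynomials: `N_{v1}(□^Υ, λ−1) = −λ(λ−3)` and `N_{v1}(□^𝓒, λ+1) = −(λ−1)(λ+2+2v^𝓒γ^𝓒)`
("Note that `−1` and `2` are `v1` indicial roots of `□^Υ` and `□^𝓒`", l.7602). [cite: Hintz2026, Lemma 8.4 proof item 4, TeX l.7597-7602] -/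
theorem item4_quotients (v γC lam : ℝ) :
    Nvl 1 (lam - 1) = -(lam * (lam - 3)) ∧ NvC v γC 2 (lam + 1) = -((lam - 1) * (lam + 2 + 2 * v * γC)) := by
  constructor
  · rw [Nvl]; ring
  · rw [NvC]; ring

/-- The printed normalisation: for `L̂(0) = ½·(2L̂(0))` the `v1` determinant is `2^{-2}` times the printed right-hand
side — the identities of Lemma 8.4's proof hold exactly for `2L̂(0)` and up to the constant `2^{-n}` for `L̂(0)`
(immaterial for roots; audit cell, two engines, all five types). [cite: Hintz2026, Lemma 8.4 proof items 1-5, TeX l.7580-7608] -/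
theorem det_N2Lv1_half (v γC γU lam : ℝ) :
    ((1 / 2 : ℝ) • N2Lv1 v γC γU lam).det =
      1 / 4 * ((lam + 1) * (lam - 2) * (lam - 3) * (lam + 2 + 2 * v * γC)) := by
  rw [Matrix.det_smul, det_N2Lv1, Fintype.card_fin]
  ring

end Literature.Geometry.Lorentzian.Hintz2026.IndicialRoots
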